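/-
Copyright (c) 2026. All rights reserved.
Released under Apache 2.0 license as described in the file LICENSE.
-/
import Summits.AtomisticToContinuum.Crystallization.Theorems.ChartedZeroExcessLayeredLatticeLiouvilleVR

/-!
# ChartedZeroExcessLayeredLatticeLiouville — part VS «FluxMoments»: the polynomial-profile moments of the flux blocks and the UNIFORM `ℓ^∞` BOUND
  of the window inverse (decomp-a2c-lens-2, g58; helper of stmt-AtomisticToContinuum-26636, leaf (LD′) `ModalLipschitzZ`; brick (3) MODE
  EXTRACTION, critic rows 938 (a) / 941 (e))

VN `window_solve` needs, for the weight `ω_L k = (1 + |k|/L)²` (`polyProfile_admissible`, modulus `θ_L u = (1 + u/L)² − 1`), the row and column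
moments `Σ_n θ_L(|m − n|)‖B m n‖ ≤ Λ < δ`.  For the flux blocks `B = fluxBlock hc hL ϱ` of VP, VR's decay `‖B m n‖ ≤ 196·F·(1 + |m − n|)⁻⁴`
gives `Λ = 588·F/L` (`fluxBlock_row_moment`, `fluxBlock_col_moment`: `θ_L(j)(j+1)⁻⁴ ≤ L⁻¹(j+1)⁻²` and `Σ_n (|m−n|+1)⁻² ≤ 3`), uniformly in `ϱ`,
in the window and in the stacking word.  With the DECAY SCALE `L(c, δ) = ⌊1176·F/δ⌋₊ + 1` (`Λ ≤ δ/2`) and `Σ_n ω_L(m − n)⁻¹ ≤ 5L`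
(`sum_inv_polyProfile_le`), VQ `flux_coercive` (`δ = κ₀ − ε/2`) and VN `window_solve` yield
★★ `flux_window_solve`: on EVERY finite window `W` and for EVERY datum `h` with `‖h‖ ≤ H` on `W` there is an increment field `d` supported in `W`
with `blockApply (fluxBlock …) W d = h` on `W` and `‖d m‖ ≤ modeConst(c, κ₀ − ε/2)·H` — the `ϱ`-, window- and word-uniform `ℓ^∞` bound of the
window inverse, the engine of the mode extraction.
-/

namespace Summit.AtomisticToContinuum.Crystallization.Theorems.ChartedZeroExcessLayeredLatticeLiouville

open Summit.AtomisticToContinuum.Crystallization.Theorems.ChartedPlanarOrderRigidityDoor (E3)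
open Finset
open scoped InnerProductSpace RealInnerProductSpace BigOperators

noncomputable section FluxMoments

variable {c : ℝ} {a b : E3} {w : ℤ → E3}

/-! ### VS.1  The polynomial modulus against the quartic decay -/

/-- `θ_L(j)·(j+1)⁻⁴ ≤ L⁻¹·(j+1)⁻²` for `L ≥ 1`: `(1 + j/L)² − 1 = (j/L)(2 + j/L) ≤ L⁻¹·j(2 + j) ≤ L⁻¹(j+1)²`. [formal bookkeeping] -/
theorem polyTheta_mul_inv_pow_four_le {L : ℝ} (hL : 1 ≤ L) (j : ℕ) :
    ((1 + ((j : ℕ) : ℝ) / L) ^ 2 - 1) * ((((j : ℕ) : ℝ) + 1)⁻¹) ^ 4 ≤ L⁻¹ * ((((j : ℕ) : ℝ) + 1)⁻¹) ^ 2 := by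
  have hL0 : 0 < L := one_pos.trans_le hL
  have hx : (0 : ℝ) ≤ ((j : ℕ) : ℝ) := Nat.cast_nonneg j
  have hx1 : ((j : ℕ) : ℝ) + 1 ≠ 0 := by positivity
  have hdiv : ((j : ℕ) : ℝ) / L ≤ ((j : ℕ) : ℝ) := div_le_self hx hL
  have h1 : (1 + ((j : ℕ) : ℝ) / L) ^ 2 - 1 ≤ L⁻¹ * (((j : ℕ) : ℝ) + 1) ^ 2 := by
    have e : (1 + ((j : ℕ) : ℝ) / L) ^ 2 - 1 = ((j : ℕ) : ℝ) / L * (2 + ((j : ℕ) : ℝ) / L) := by ring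
    have e2 : (((j : ℕ) : ℝ) + 1) ^ 2 = ((j : ℕ) : ℝ) * (2 + ((j : ℕ) : ℝ)) + 1 := by ring
    rw [e]
    calc ((j : ℕ) : ℝ) / L * (2 + ((j : ℕ) : ℝ) / L) ≤ ((j : ℕ) : ℝ) / L * (2 + ((j : ℕ) : ℝ)) := by gcongr
      _ = L⁻¹ * (((j : ℕ) : ℝ) * (2 + ((j : ℕ) : ℝ))) := by rw [div_eq_mul_inv]; ring
      _ ≤ L⁻¹ * (((j : ℕ) : ℝ) + 1) ^ 2 := mul_le_mul_of_nonneg_left (by rw [e2]; linarith) (inv_nonneg.mpr hL0.le)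
  calc ((1 + ((j : ℕ) : ℝ) / L) ^ 2 - 1) * ((((j : ℕ) : ℝ) + 1)⁻¹) ^ 4
      ≤ L⁻¹ * (((j : ℕ) : ℝ) + 1) ^ 2 * ((((j : ℕ) : ℝ) + 1)⁻¹) ^ 4 := mul_le_mul_of_nonneg_right h1 (by positivity)
    _ = L⁻¹ * ((((j : ℕ) : ℝ) + 1)⁻¹) ^ 2 := by
        rw [show ((((j : ℕ) : ℝ) + 1)⁻¹) ^ 4 = ((((j : ℕ) : ℝ) + 1)⁻¹) ^ 2 * ((((j : ℕ) : ℝ) + 1)⁻¹) ^ 2 by ring, ← mul_assoc,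
          mul_assoc L⁻¹, ← mul_pow, mul_inv_cancel₀ hx1, one_pow, mul_one]

/-- the ONE-DIMENSIONAL inverse-square sum `Σ_{n ∈ W} (|m − n| + 1)⁻² ≤ 3` (`1` at `n = m`, `≤ 1` on each side by the inverse-square tail).
[formal bookkeeping] -/
theorem sum_inv_sq_natAbs_succ_le (W : Finset ℤ) (m : ℤ) : ∑ n ∈ W, (((((m - n).natAbs : ℕ) : ℝ) + 1)⁻¹) ^ 2 ≤ 3 := by
  classical
  have hconv : ∀ n : ℤ, (((((m - n).natAbs : ℕ) : ℝ) + 1)⁻¹) ^ 2 = (((((m - n).natAbs + 1 : ℕ)) : ℝ) ^ 2)⁻¹ := fun n => by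
    push_cast; rw [inv_pow]
  simp_rw [hconv]
  rw [← sum_filter_add_sum_filter_not W (fun n : ℤ => n < m),
    ← sum_filter_add_sum_filter_not (W.filter fun n : ℤ => ¬ n < m) (fun n : ℤ => m < n)]
  have hlt : ∑ n ∈ W with n < m, (((((m - n).natAbs + 1 : ℕ)) : ℝ) ^ 2)⁻¹ ≤ 2 / (((1 : ℕ) : ℝ) + 1) := by
    refine sum_inv_sq_le_of_injOn (fun n : ℤ => (m - n).natAbs + 1) ?_ fun n hn => ?_
    · intro n hn n' hn' h
      have h1 := (mem_filter.mp (mem_coe.mp hn)).2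
      have h2 := (mem_filter.mp (mem_coe.mp hn')).2
      have h' : (m - n).natAbs + 1 = (m - n').natAbs + 1 := h
      omega
    · have := (mem_filter.mp hn).2
      omega
  have hgt : ∑ n ∈ (W.filter fun n : ℤ => ¬ n < m) with m < n, (((((m - n).natAbs + 1 : ℕ)) : ℝ) ^ 2)⁻¹ ≤ 2 / (((1 : ℕ) : ℝ) + 1) := by
    refine sum_inv_sq_le_of_injOn (fun n : ℤ => (m - n).natAbs + 1) ?_ fun n hn => ?_
    · intro n hn n' hn' h
      have h1 := (mem_filter.mp (mem_coe.mp hn)).2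
      have h2 := (mem_filter.mp (mem_coe.mp hn')).2
      have h' : (m - n).natAbs + 1 = (m - n').natAbs + 1 := h
      omega
    · have := (mem_filter.mp hn).2
      omega
  have heq : ∑ n ∈ (W.filter fun n : ℤ => ¬ n < m) with ¬ m < n, (((((m - n).natAbs + 1 : ℕ)) : ℝ) ^ 2)⁻¹ ≤ 1 :=
    calc ∑ n ∈ (W.filter fun n : ℤ => ¬ n < m) with ¬ m < n, (((((m - n).natAbs + 1 : ℕ)) : ℝ) ^ 2)⁻¹
        ≤ ∑ n ∈ ({m} : Finset ℤ), (((((m - n).natAbs + 1 : ℕ)) : ℝ) ^ 2)⁻¹ :=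
          sum_le_sum_of_subset_of_nonneg
            (fun n hn => by
              have h1 := mem_filter.mp hn
              have h2 := (mem_filter.mp h1.1).2
              rw [mem_singleton]; omega)
            fun _ _ _ => by positivity
      _ = 1 := by simp
  have h2 : (2 : ℝ) / (((1 : ℕ) : ℝ) + 1) = 1 := by norm_num
  linarith

/-- the same sum over the first index. [formal bookkeeping] -/
theorem sum_inv_sq_natAbs_succ_le' (W : Finset ℤ) (n : ℤ) : ∑ m ∈ W, (((((m - n).natAbs : ℕ) : ℝ) + 1)⁻¹) ^ 2 ≤ 3 := by
  have h : ∀ m : ℤ, (m - n).natAbs = (n - m).natAbs := fun m => by omega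
  simp_rw [h]
  exact sum_inv_sq_natAbs_succ_le W n

/-! ### VS.2  ★ The row and column moments of the flux blocks -/

/-- ★ ROW MOMENT: `Σ_{n ∈ W} θ_L(|m − n|)·‖fluxBlock m n‖ ≤ 588·F(c)/L` for `L ≥ 1` — hypothesis `hrow` of VN `window_solve` for the polynomial
profile, uniformly in `ϱ`, `W` and the stacking word. [this file, g58] -/
theorem fluxBlock_row_moment (hc : 0 < c) (hL : IsLayeredCrystal c a b w) (ϱ : ℝ) {L : ℝ} (hL1 : 1 ≤ L) (W : Finset ℤ) (m : ℤ) :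
    ∑ n ∈ W, ((1 + ((((m - n).natAbs : ℕ)) : ℝ) / L) ^ 2 - 1) * ‖fluxBlock hc hL ϱ m n‖ ≤ 588 * kernelConst c / L := by
  have hF := kernelConst_nonneg hc
  have hL0 : 0 < L := one_pos.trans_le hL1
  have hθ0 : ∀ j : ℕ, 0 ≤ (1 + ((j : ℕ) : ℝ) / L) ^ 2 - 1 := fun j =>
    sub_nonneg.mpr (one_le_pow₀ (le_add_of_nonneg_right (by positivity)))
  calc ∑ n ∈ W, ((1 + ((((m - n).natAbs : ℕ)) : ℝ) / L) ^ 2 - 1) * ‖fluxBlock hc hL ϱ m n‖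
      ≤ ∑ n ∈ W, ((1 + ((((m - n).natAbs : ℕ)) : ℝ) / L) ^ 2 - 1) *
          (196 * kernelConst c * ((((((m - n).natAbs : ℕ)) : ℝ) + 1)⁻¹) ^ 4) :=
        sum_le_sum fun n _ => mul_le_mul_of_nonneg_left (norm_fluxBlock_le_decay hc hL ϱ m n) (hθ0 _)
    _ = 196 * kernelConst c * ∑ n ∈ W, ((1 + ((((m - n).natAbs : ℕ)) : ℝ) / L) ^ 2 - 1) * ((((((m - n).natAbs : ℕ)) : ℝ) + 1)⁻¹) ^ 4 := by
        rw [mul_sum]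
        exact sum_congr rfl fun n _ => by ring
    _ ≤ 196 * kernelConst c * ∑ n ∈ W, L⁻¹ * ((((((m - n).natAbs : ℕ)) : ℝ) + 1)⁻¹) ^ 2 :=
        mul_le_mul_of_nonneg_left (sum_le_sum fun n _ => polyTheta_mul_inv_pow_four_le hL1 _) (mul_nonneg (by norm_num) hF)
    _ = 196 * kernelConst c * L⁻¹ * ∑ n ∈ W, ((((((m - n).natAbs : ℕ)) : ℝ) + 1)⁻¹) ^ 2 := by rw [← mul_sum]; ring
    _ ≤ 196 * kernelConst c * L⁻¹ * 3 :=
        mul_le_mul_of_nonneg_left (sum_inv_sq_natAbs_succ_le W m) (mul_nonneg (mul_nonneg (by norm_num) hF) (inv_nonneg.mpr hL0.le))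
    _ = 588 * kernelConst c / L := by rw [div_eq_mul_inv]; ring

/-- ★ COLUMN MOMENT: `Σ_{m ∈ W} θ_L(|m − n|)·‖fluxBlock m n‖ ≤ 588·F(c)/L` — hypothesis `hcol` of VN `window_solve`. [this file, g58] -/
theorem fluxBlock_col_moment (hc : 0 < c) (hL : IsLayeredCrystal c a b w) (ϱ : ℝ) {L : ℝ} (hL1 : 1 ≤ L) (W : Finset ℤ) (n : ℤ) :
    ∑ m ∈ W, ((1 + ((((m - n).natAbs : ℕ)) : ℝ) / L) ^ 2 - 1) * ‖fluxBlock hc hL ϱ m n‖ ≤ 588 * kernelConst c / L := by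
  have hF := kernelConst_nonneg hc
  have hL0 : 0 < L := one_pos.trans_le hL1
  have hθ0 : ∀ j : ℕ, 0 ≤ (1 + ((j : ℕ) : ℝ) / L) ^ 2 - 1 := fun j =>
    sub_nonneg.mpr (one_le_pow₀ (le_add_of_nonneg_right (by positivity)))
  calc ∑ m ∈ W, ((1 + ((((m - n).natAbs : ℕ)) : ℝ) / L) ^ 2 - 1) * ‖fluxBlock hc hL ϱ m n‖
      ≤ ∑ m ∈ W, ((1 + ((((m - n).natAbs : ℕ)) : ℝ) / L) ^ 2 - 1) *
          (196 * kernelConst c * ((((((m - n).natAbs : ℕ)) : ℝ) + 1)⁻¹) ^ 4) :=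
        sum_le_sum fun m _ => mul_le_mul_of_nonneg_left (norm_fluxBlock_le_decay hc hL ϱ m n) (hθ0 _)
    _ = 196 * kernelConst c * ∑ m ∈ W, ((1 + ((((m - n).natAbs : ℕ)) : ℝ) / L) ^ 2 - 1) * ((((((m - n).natAbs : ℕ)) : ℝ) + 1)⁻¹) ^ 4 := by
        rw [mul_sum]
        exact sum_congr rfl fun m _ => by ring
    _ ≤ 196 * kernelConst c * ∑ m ∈ W, L⁻¹ * ((((((m - n).natAbs : ℕ)) : ℝ) + 1)⁻¹) ^ 2 :=
        mul_le_mul_of_nonneg_left (sum_le_sum fun m _ => polyTheta_mul_inv_pow_four_le hL1 _) (mul_nonneg (by norm_num) hF)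
    _ = 196 * kernelConst c * L⁻¹ * ∑ m ∈ W, ((((((m - n).natAbs : ℕ)) : ℝ) + 1)⁻¹) ^ 2 := by rw [← mul_sum]; ring
    _ ≤ 196 * kernelConst c * L⁻¹ * 3 :=
        mul_le_mul_of_nonneg_left (sum_inv_sq_natAbs_succ_le' W n) (mul_nonneg (mul_nonneg (by norm_num) hF) (inv_nonneg.mpr hL0.le))
    _ = 588 * kernelConst c / L := by rw [div_eq_mul_inv]; ring

/-! ### VS.3  The inverse weights are summable: `Σ_n ω_L(m − n)⁻¹ ≤ 5L` -/

/-- `Σ_{n ∈ W} (1 + |m − n|/L)⁻² ≤ 5L` for a natural scale `L ≥ 1` (`= L²·Σ_n (L + |m − n|)⁻²`: the central term `L⁻²` and two inverse-square tails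
`≤ 2/(L+1)` each). [formal bookkeeping] -/
theorem sum_inv_polyProfile_le {L : ℕ} (hL : 1 ≤ L) (W : Finset ℤ) (m : ℤ) :
    ∑ n ∈ W, ((1 + ((((m - n).natAbs : ℕ)) : ℝ) / ((L : ℕ) : ℝ)) ^ 2)⁻¹ ≤ 5 * ((L : ℕ) : ℝ) := by
  classical
  have hL0 : (0 : ℝ) < ((L : ℕ) : ℝ) := by exact_mod_cast hL
  have hL1 : (1 : ℝ) ≤ ((L : ℕ) : ℝ) := by exact_mod_cast hL
  have hconv : ∀ n : ℤ, ((1 + ((((m - n).natAbs : ℕ)) : ℝ) / ((L : ℕ) : ℝ)) ^ 2)⁻¹ =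
      ((L : ℕ) : ℝ) ^ 2 * ((((L + (m - n).natAbs : ℕ)) : ℝ) ^ 2)⁻¹ := fun n => by
    have e : 1 + ((((m - n).natAbs : ℕ)) : ℝ) / ((L : ℕ) : ℝ) = (((L + (m - n).natAbs : ℕ)) : ℝ) / ((L : ℕ) : ℝ) := by
      rw [Nat.cast_add, add_div, div_self hL0.ne']
    rw [e, div_pow, inv_div, div_eq_mul_inv]
  simp_rw [hconv]
  rw [← mul_sum]
  have hsum : ∑ n ∈ W, ((((L + (m - n).natAbs : ℕ)) : ℝ) ^ 2)⁻¹ ≤ (((L : ℕ) : ℝ) ^ 2)⁻¹ + 4 / (((L : ℕ) : ℝ) + 1) := by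
    rw [← sum_filter_add_sum_filter_not W (fun n : ℤ => n < m),
      ← sum_filter_add_sum_filter_not (W.filter fun n : ℤ => ¬ n < m) (fun n : ℤ => m < n)]
    have hlt : ∑ n ∈ W with n < m, ((((L + (m - n).natAbs : ℕ)) : ℝ) ^ 2)⁻¹ ≤ 2 / (((L : ℕ) : ℝ) + 1) := by
      refine sum_inv_sq_le_of_injOn (fun n : ℤ => L + (m - n).natAbs) ?_ fun n hn => ?_
      · intro n hn n' hn' h
        have h1 := (mem_filter.mp (mem_coe.mp hn)).2
        have h2 := (mem_filter.mp (mem_coe.mp hn')).2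
        have h' : L + (m - n).natAbs = L + (m - n').natAbs := h
        omega
      · have := (mem_filter.mp hn).2
        omega
    have hgt : ∑ n ∈ (W.filter fun n : ℤ => ¬ n < m) with m < n, ((((L + (m - n).natAbs : ℕ)) : ℝ) ^ 2)⁻¹ ≤ 2 / (((L : ℕ) : ℝ) + 1) := by
      refine sum_inv_sq_le_of_injOn (fun n : ℤ => L + (m - n).natAbs) ?_ fun n hn => ?_
      · intro n hn n' hn' h
        have h1 := (mem_filter.mp (mem_coe.mp hn)).2
        have h2 := (mem_filter.mp (mem_coe.mp hn')).2
        have h' : L + (m - n).natAbs = L + (m - n').natAbs := h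
        omega
      · have := (mem_filter.mp hn).2
        omega
    have heq : ∑ n ∈ (W.filter fun n : ℤ => ¬ n < m) with ¬ m < n, ((((L + (m - n).natAbs : ℕ)) : ℝ) ^ 2)⁻¹ ≤ (((L : ℕ) : ℝ) ^ 2)⁻¹ :=
      calc ∑ n ∈ (W.filter fun n : ℤ => ¬ n < m) with ¬ m < n, ((((L + (m - n).natAbs : ℕ)) : ℝ) ^ 2)⁻¹
          ≤ ∑ n ∈ ({m} : Finset ℤ), ((((L + (m - n).natAbs : ℕ)) : ℝ) ^ 2)⁻¹ :=
            sum_le_sum_of_subset_of_nonneg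
              (fun n hn => by
                have h1 := mem_filter.mp hn
                have h2 := (mem_filter.mp h1.1).2
                rw [mem_singleton]; omega)
              fun _ _ _ => by positivity
        _ = (((L : ℕ) : ℝ) ^ 2)⁻¹ := by simp
    have h4 : (4 : ℝ) / (((L : ℕ) : ℝ) + 1) = 2 / (((L : ℕ) : ℝ) + 1) + 2 / (((L : ℕ) : ℝ) + 1) := by ring
    linarith
  have hfrac : ((L : ℕ) : ℝ) ^ 2 / (((L : ℕ) : ℝ) + 1) ≤ ((L : ℕ) : ℝ) := by
    rw [div_le_iff₀ (by positivity)]; nlinarith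
  calc ((L : ℕ) : ℝ) ^ 2 * ∑ n ∈ W, ((((L + (m - n).natAbs : ℕ)) : ℝ) ^ 2)⁻¹
      ≤ ((L : ℕ) : ℝ) ^ 2 * ((((L : ℕ) : ℝ) ^ 2)⁻¹ + 4 / (((L : ℕ) : ℝ) + 1)) := mul_le_mul_of_nonneg_left hsum (by positivity)
    _ = 1 + 4 * (((L : ℕ) : ℝ) ^ 2 / (((L : ℕ) : ℝ) + 1)) := by rw [mul_add, mul_inv_cancel₀ (by positivity)]; ring
    _ ≤ 1 + 4 * ((L : ℕ) : ℝ) := by linarith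
    _ ≤ 5 * ((L : ℕ) : ℝ) := by linarith

/-! ### VS.4  ★★ The uniform `ℓ^∞` bound of the window inverse -/

/-- the DECAY SCALE `L(c, δ) = ⌊1176·F(c)/δ⌋₊ + 1` of the polynomial window weight (so that the moments `588·F/L` are at most `δ/2`). [this file, g58] -/
def decayScale (c δ : ℝ) : ℕ := ⌊1176 * kernelConst c / δ⌋₊ + 1

/-- `L(c, δ) ≥ 1`. [formal bookkeeping] -/
theorem one_le_decayScale (c δ : ℝ) : 1 ≤ decayScale c δ := Nat.le_add_left 1 _

/-- at any scale `L ≥ L(c, δ)` the moments are at most `δ/2`. [formal bookkeeping] -/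
theorem moment_le_half_of_decayScale_le (hc : 0 < c) {δ : ℝ} (hδ : 0 < δ) {L : ℕ} (hL : decayScale c δ ≤ L) :
    588 * kernelConst c / ((L : ℕ) : ℝ) ≤ δ / 2 := by
  have hF := kernelConst_nonneg hc
  have hL1 : 1 ≤ L := (one_le_decayScale c δ).trans hL
  have hLpos : (0 : ℝ) < ((L : ℕ) : ℝ) := by exact_mod_cast hL1
  have hlt : 1176 * kernelConst c / δ < ((L : ℕ) : ℝ) := by
    have h1 : 1176 * kernelConst c / δ < ((decayScale c δ : ℕ) : ℝ) := by
      unfold decayScale; push_cast; exact Nat.lt_floor_add_one _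
    exact h1.trans_le (by exact_mod_cast hL)
  rw [div_lt_iff₀ hδ] at hlt
  rw [div_le_iff₀ hLpos]
  linarith

/-- the MODE CONSTANT `10·L(c, δ)/δ`: the `ϱ`-, window- and word-uniform `ℓ^∞` bound of the window inverse of the flux blocks. [this file, g58] -/
def modeConst (c δ : ℝ) : ℝ := 10 * ((decayScale c δ : ℕ) : ℝ) / δ

/-- `modeConst c δ ≥ 0` for `δ > 0`. [formal bookkeeping] -/
theorem modeConst_nonneg (c : ℝ) {δ : ℝ} (hδ : 0 < δ) : 0 ≤ modeConst c δ := by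
  unfold modeConst; positivity

/-- ★★ THE UNIFORM WINDOW INVERSE: under VQ's hypotheses (`CoerciveZ (layeredKernel a b w) κ₀`, tail constant `ε < 2κ₀`, `0 ≤ ϱ`), on EVERY finite
window `W` of gaps and for EVERY datum `h` bounded by `H` on `W`, the flux-block system `blockApply (fluxBlock …) W d = h` has a solution `d`
supported in `W` with `‖d m‖ ≤ modeConst(c, κ₀ − ε/2)·H` — a bound uniform in `ϱ`, in the window and in the stacking word (VQ `flux_coercive`,
VN `window_solve` with the polynomial profile at the decay scale, `fluxBlock_row/col_moment`, `sum_inv_polyProfile_le`). [this file, g58] -/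
theorem flux_window_solve (hc : 0 < c) (hL : IsLayeredCrystal c a b w) {κ₀ ε ϱ : ℝ} (hϱ : 0 ≤ ϱ) (hε : ε < 2 * κ₀)
    (hK : CoerciveZ (layeredKernel a b w) κ₀)
    (hT : ∀ φ : Cell 2 → ℤ → E3, HasFiniteSupport φ → Summable (tailFam ϱ a b w φ) ∧ ∑' x, tailFam ϱ a b w φ x ≤ ε * nnFormZ φ)
    (W : Finset ℤ) (h : ℤ → E3) {H : ℝ} (hH : ∀ n ∈ W, ‖h n‖ ≤ H) :
    ∃ d : ℤ → E3, (∀ m, m ∉ W → d m = 0) ∧ (∀ m ∈ W, blockApply (fluxBlock hc hL ϱ) W d m = h m) ∧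
      ∀ m ∈ W, ‖d m‖ ≤ modeConst c (κ₀ - ε / 2) * H := by
  have hδ : 0 < κ₀ - ε / 2 := by linarith
  obtain ⟨L, hLdef⟩ : ∃ L : ℕ, L = decayScale c (κ₀ - ε / 2) := ⟨_, rfl⟩
  have hL1 : 1 ≤ L := hLdef ▸ one_le_decayScale c (κ₀ - ε / 2)
  have hL1R : (1 : ℝ) ≤ ((L : ℕ) : ℝ) := by exact_mod_cast hL1
  have hL0R : (0 : ℝ) < ((L : ℕ) : ℝ) := one_pos.trans_le hL1R
  have hco := flux_coercive hc hL hϱ hε.le hK hT W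
  have hω : ∀ k : ℤ, 0 < (1 + (((k.natAbs : ℕ)) : ℝ) / ((L : ℕ) : ℝ)) ^ 2 := fun k => by positivity
  have hω0 : (1 + ((((0 : ℤ).natAbs : ℕ)) : ℝ) / ((L : ℕ) : ℝ)) ^ 2 = 1 := by simp
  have hΛ' : 588 * kernelConst c / ((L : ℕ) : ℝ) ≤ (κ₀ - ε / 2) / 2 := moment_le_half_of_decayScale_le hc hδ hLdef.symm.le
  have hΛ : 588 * kernelConst c / ((L : ℕ) : ℝ) < κ₀ - ε / 2 := hΛ'.trans_lt (by linarith)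
  obtain ⟨d, hd0, hdh, hdb⟩ := window_solve (B := fluxBlock hc hL ϱ) (W := W) (δ := κ₀ - ε / 2) (Λ := 588 * kernelConst c / ((L : ℕ) : ℝ))
    (ω := fun k : ℤ => (1 + (((k.natAbs : ℕ)) : ℝ) / ((L : ℕ) : ℝ)) ^ 2) (θ := fun u : ℕ => (1 + ((u : ℕ) : ℝ) / ((L : ℕ) : ℝ)) ^ 2 - 1)
    hδ hco hω hω0 (fun m n => polyProfile_admissible hL0R m n) (fun m _ => fluxBlock_row_moment hc hL ϱ hL1R W m)
    (fun n _ => fluxBlock_col_moment hc hL ϱ hL1R W n) hΛ h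
  refine ⟨d, hd0, hdh, fun m hm => ?_⟩
  have hHm : 0 ≤ H := (norm_nonneg _).trans (hH m hm)
  have hgap0 : 0 < κ₀ - ε / 2 - 588 * kernelConst c / ((L : ℕ) : ℝ) := by linarith
  have hgap : (κ₀ - ε / 2 - 588 * kernelConst c / ((L : ℕ) : ℝ))⁻¹ ≤ 2 / (κ₀ - ε / 2) :=
    calc (κ₀ - ε / 2 - 588 * kernelConst c / ((L : ℕ) : ℝ))⁻¹ ≤ ((κ₀ - ε / 2) / 2)⁻¹ := inv_anti₀ (by positivity) (by linarith)
      _ = 2 / (κ₀ - ε / 2) := inv_div _ _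
  have hS := sum_inv_polyProfile_le hL1 W m
  have hS0 : 0 ≤ ∑ n ∈ W, ((1 + ((((m - n).natAbs : ℕ)) : ℝ) / ((L : ℕ) : ℝ)) ^ 2)⁻¹ := sum_nonneg fun _ _ => by positivity
  calc ‖d m‖ ≤ (κ₀ - ε / 2 - 588 * kernelConst c / ((L : ℕ) : ℝ))⁻¹ *
        ∑ n ∈ W, ((1 + ((((m - n).natAbs : ℕ)) : ℝ) / ((L : ℕ) : ℝ)) ^ 2)⁻¹ * ‖h n‖ := hdb m hm
    _ ≤ (κ₀ - ε / 2 - 588 * kernelConst c / ((L : ℕ) : ℝ))⁻¹ *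
        ∑ n ∈ W, ((1 + ((((m - n).natAbs : ℕ)) : ℝ) / ((L : ℕ) : ℝ)) ^ 2)⁻¹ * H :=
        mul_le_mul_of_nonneg_left (sum_le_sum fun n hn => mul_le_mul_of_nonneg_left (hH n hn) (by positivity)) (inv_nonneg.mpr hgap0.le)
    _ = (κ₀ - ε / 2 - 588 * kernelConst c / ((L : ℕ) : ℝ))⁻¹ *
        ((∑ n ∈ W, ((1 + ((((m - n).natAbs : ℕ)) : ℝ) / ((L : ℕ) : ℝ)) ^ 2)⁻¹) * H) := by rw [sum_mul]
    _ ≤ 2 / (κ₀ - ε / 2) * (5 * ((L : ℕ) : ℝ) * H) :=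
        mul_le_mul hgap (mul_le_mul_of_nonneg_right hS hHm) (mul_nonneg hS0 hHm) (by positivity)
    _ = modeConst c (κ₀ - ε / 2) * H := by unfold modeConst; rw [← hLdef, div_eq_mul_inv]; ring

end FluxMoments

end Summit.AtomisticToContinuum.Crystallization.Theorems.ChartedZeroExcessLayeredLatticeLiouville
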